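import Summits.BirchSwinnertonDyer.BirchSwinnertonDyer.Theorems.ClassRecordThreeCornerAtThreeShimuraInertDisplayOfPrimitives
import Summits.BirchSwinnertonDyer.BirchSwinnertonDyer.Theorems.ClassRecordThreeShimuraKolyvaginCebotarevOfImageOdd
import Summits.BirchSwinnertonDyer.BirchSwinnertonDyer.Theorems.ClassRecordThreeShimuraKolyvaginTorsionOfNeg
import Literature.NumberTheory.GaloisCohomology.PoitouTateNumberField
import HarnessLib

/-!
# The IMAGE-KEYED Kolyvagin ORDER machine — the END at ANY odd prime `p ∈ S` (INERT in `K`) for `E[p]` IRREDUCIBLE with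
# `−1 ∈ ρ̄_{E,p}(Γ_ℚ)`: Kolyvagin's bound `#Ш(E/K)[p^∞] ≤ p^(2·ord_p[E(K):ℤy])` for the bottom CM point of `X_{N⁺,N⁻}`, from
# `casselsTate_levelInputs` and the printed CM-point labels (Poitou–Tate being a tree theorem) — the by-product for crux 19065 `NonSurjCorner`
# (`p ∈ {5, 7}`, non-surjective inert frames; seat corner5-p2) of lane B's work on crux `CornerAtThree` (item
# stmt-BirchSwinnertonDyer-19111; cell `bsd-stepL`, seat `bsd-stepL-corner3-p2` g5; `--supports … --as helper`)

HONEST FRAMING: THEOREMS ONLY (no definition, no named fact, no `sorry`); nothing here is a BSD class theorem; no census label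
moves (T7); no item is closed. CONDITIONAL on the displayed binders (`hCT : casselsTate_levelInputs K`, UNPROVED Literature fact;
Poitou–Tate is fed from its tree theorem `poitouTate_sum_localTatePairing_eq_zero_holds`; the bare CM family with its five printed labels and the guarded index clause; `E[p]` irreducible; `hneg`). The one
genuine image hypothesis beyond irreducibility is `hneg : −1 ∈ ρ̄_{E,p}(Γ_ℚ)` (automatic at `p = 3` for every irreducible `E[3]`,
shim3b `exists_smul_eq_neg_three_of_irr…`; at `p = 7` on the corner a genuine datum, corner-p1 g11's «−1@7» note). BSD is not
proved by any of this.

## What is proved (namespace `…Theorems.ShimuraKolyvaginOfImage`)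

* `kolyvaginImageInputs_of_irr_of_neg` — the four image inputs (hIz) (hIs) (hIc) (hIt) of the machine at ANY odd `p` from `E[p]`
  irreducible, `−1 ∈ ρ̄_{E,p}(Γ_ℚ)`, `K` imaginary quadratic with the Shimura locus clauses `hin` ∕ `hsp` and `p ∤ d_K` (Gross's
  disjointness prime `q ∣ d_K`, `q ∤ pN`): shim3b's `exists_smul_eq_neg_baseChange_of_exists`, `hasIrreducibleModPGaloisRep_baseChange`,
  `exists_eq_zsmul_baseChange_of_irr`, `torsionBy_pow_eq_bot_of_neg`, packaged.
* **`natCard_sha_primary_le_of_shimuraLabels_of_irr_of_neg_of_casselsTate`** — the bound at `p ∈ S` inert, `p` odd,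
  `E[p]` irreducible, `−1 ∈ ρ̄_{E,p}(Γ_ℚ)`: the `p`-generic END
  (`natCard_sha_primary_le_of_shimuraLabels_of_imageInputs_of_casselsTate_of_poitouTate`) with these inputs and x11b3's ring-class
  no-torsion (`NoTorsionIrr.torsionBy_pow_ringClassField_eq_bot_of_hasIrreducibleModPGaloisRep`; `p ∤ d_K` since `p ∈ S`, `p ∤ m`).
  NO surjectivity, NO `p ≥ 5`, NO Tamagawa ∕ Kodaira–Néron clause. @corner5-p2: at a 19065 inert frame (`p ∈ {5,7}`, `p ∈ S`)
  feed `hneg` and the primitives of `shimuraCurve_heegnerSystem_primitivesGuarded`'s shape (minus `ρ̄` onto).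
[cite: McCallumLMS1991, §1 Theorem (Kolyvagin), §3 Cor. 3.2, §4 Lemma 4.3, Lemma 4.6, §5 Lemma 5.1, Cor. 5.6]
[cite: GrossLMS1991, §2, §§3–5, Prop. 6.2 (1), §9 (PDF p. 227), §10] [cite: Howard2004Duke, Thm. 3.2.2 (proof)]
[cite: MilneADT2006, Ch. I Thm. 4.10(b), Thm. 6.13(a)] [cite: Kim2022HigherGZ, §2.1 and Thm. 4.3 (printed twin p ≥ 5, ρ̄ onto)]
presearch: «Kolyvagin order bound on X_{N⁺,N⁻}, p ∣ N⁻, non-surjective irreducible image» → NOT IN PRINT (Kim 2024 Thm 4.3 `ρ̄` onto;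
cell D8 audit; corner5-p2 g0–g4 briefs) — beyond-print: YES (kernel modulo the named inputs).
-/

set_option autoImplicit false
set_option linter.dupNamespace false

noncomputable section

open scoped Classical AddSubgroup

open WeierstrassCurve NumberField IsDedekindDomain Field Function Finset Literature.NumberTheory.EllipticCurves
  Literature.NumberTheory.GaloisRepresentations Literature.NumberTheory.GaloisCohomology
  Literature.NumberTheory.EllipticCurves.KolyvaginCocycle Literature.NumberTheory.EllipticCurves.RingClassField
  Literature.NumberTheory.EllipticCurves.ModularForms Literature.NumberTheory.EllipticCurves.Rank1Residual
  Summit.BirchSwinnertonDyer.Rank1Residual Summit.BirchSwinnertonDyer.Rank1Residual.X11b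

universe u

namespace Summit.BirchSwinnertonDyer.BirchSwinnertonDyer.Theorems.ShimuraKolyvaginOfImage

open Summit.BirchSwinnertonDyer.BirchSwinnertonDyer.Theorems.ShimuraKolyvaginImageInputs

/-! ### §1 The four image inputs at any odd `p` from `Irr` and `−1 ∈ ρ̄(Γ_ℚ)` -/

/-- **The four image inputs of the Kolyvagin machine at ANY odd prime `p` from `E[p]` irreducible and `−1 ∈ ρ̄_{E,p}(Γ_ℚ)`.** For
`E = W/ℚ` of conductor `N`, `K` imaginary quadratic, an inert set `S` of primes of `N` none dividing `d_K`, every other prime of `N`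
split in `K`, and `p ∤ d_K`: (hIz) some `z ∈ Γ_K` acts as `−1` on `E(K̄)[p]`; (hIs) `E(K̄)[p]` is a simple `Γ_K`-module; (hIc) every
`Γ_K`-equivariant endomorphism of `E(K̄)[p]` is a homothety; (hIt) `E(K)[p] = 0`. Gross's disjointness prime `q ∣ d_K`, `q ∤ pN`
(`exists_prime_dvd_discr_not_dvd`) feeds shim3b g4's four lemmas. [cite: GrossLMS1991, §9 (PDF p. 227, before Prop. 9.1) and Prop. 9.3]
[cite: Cha2005, Lemmas 22–23] -/
theorem kolyvaginImageInputs_of_irr_of_neg (K : Type u) [Field K] [NumberField K] (W : WeierstrassCurve ℚ) [W.IsElliptic]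
    {N : ℕ} (S : Finset ℕ) (hN : W.conductorNorm ℤ = N) {p : ℕ} [Fact p.Prime] (hp2 : p ≠ 2)
    (hirr : W.HasIrreducibleModPGaloisRep p)
    (hneg : ∃ γ : absoluteGaloisGroup ℚ, ∀ P : geomTorsion W p, γ • P = -P)
    (hK : IsImaginaryQuadratic K)
    (hS : ∀ ℓ ∈ S, ℓ.Prime ∧ ℓ ∣ N ∧ ¬ ℓ ^ 2 ∣ N ∧
      ((Ideal.span {(ℓ : ℤ)}).primesOver (𝓞 K)).ncard = 1 ∧ ¬ (ℓ : ℤ) ∣ NumberField.discr K)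
    (hsplit : ∀ ℓ : ℕ, ℓ.Prime → ℓ ∣ N → ℓ ∉ S →
      ((Ideal.span {(ℓ : ℤ)}).primesOver (𝓞 K)).ncard = 2)
    (hpd : ¬ (p : ℤ) ∣ NumberField.discr K) :
    (∃ z : absoluteGaloisGroup K,
        ∀ Q : geomTorsion (W.baseChange K) (p : ℤ), z • Q = -Q) ∧
      (W.baseChange K).HasIrreducibleModPGaloisRep p ∧
      (∀ f : geomTorsion (W.baseChange K) (p : ℤ) →+ geomTorsion (W.baseChange K) (p : ℤ),
        (∀ (g : absoluteGaloisGroup K) (t : geomTorsion (W.baseChange K) (p : ℤ)),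
          f (g • t) = g • f t) → ∃ k : ℤ, ∀ t, f t = k • t) ∧
      AddSubgroup.torsionBy (W.baseChange K).toAffine.Point (p : ℤ) = ⊥ := by
  have hp : p.Prime := Fact.out
  -- a prime `q ∣ d_K` with `q ∤ N`, `q ≠ p`
  obtain ⟨q, hq, hqd, hqN⟩ :=
    exists_prime_dvd_discr_not_dvd K hK.1 S (fun ℓ hℓ ↦ (hS ℓ hℓ).2.2.2.2) hsplit
  have hqN' : ¬ q ∣ W.conductorNorm ℤ := by rwa [hN]
  have hqp : ¬ (q : ℤ) ∣ (p : ℤ) := fun h ↦ by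
    have h' : q ∣ p := by exact_mod_cast h
    have := (Nat.prime_dvd_prime_iff_eq hq hp).mp h'
    subst this
    exact hpd hqd
  refine ⟨?_, ?_, ?_, ?_⟩
  · exact ShimuraKolyvaginCebotarevOfImageOdd.exists_smul_eq_neg_baseChange_of_exists W K hK.1 hq hqd hqN' hqp hneg
  · exact hasIrreducibleModPGaloisRep_baseChange W K hK.1 hq hqd hqN' hqp hirr
  · exact fun f hf ↦ exists_eq_zsmul_baseChange_of_irr W K hK.1 hq hqd hqN' hp2 hqp hirr f hf
  · have h := ShimuraKolyvaginTorsionOfNeg.torsionBy_pow_eq_bot_of_neg W K hK.1 hq hqd hqN' hp hp2 hqp hneg (M := 1) le_rfl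
    simpa only [pow_one] using h

/-! ### §2 The END at an inert odd `p` for irreducible `E[p]` with `−1` in the image -/

-- Cup products need `LocallyCompactSpace Γ_K`; as in the tree's Cassels–Tate files.
attribute [local instance] absoluteGaloisGroup_compactSpace

-- `CharZero` of the completions (the Cassels–Tate local terms), as in the tree's files.
attribute [local instance] charZero_placeCompletion

variable {K : Type} [Field K] [NumberField K] {W : WeierstrassCurve ℚ}

/-- **Kolyvagin's ORDER bound `#Ш(E/K)[p^∞] ≤ p^(2·ord_p[E(K):ℤy])` at an odd prime `p ∈ S` (INERT in `K`) for `E[p]` IRREDUCIBLE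
with `−1 ∈ ρ̄_{E,p}(Γ_ℚ)`** — for the bottom point `y` of a bare CM family on `X_{N⁺,N⁻}` carrying the printed labels (B2)–(B5) and
the guarded index clause, from `casselsTate_levelInputs K` (Poitou–Tate fed from its tree theorem). The `p`-generic image-keyed END with §1's inputs and
x11b3's ring-class no-torsion (`p ∤ d_K` because `p ∈ S`; `p ∤ m` on the Kolyvagin levels). NO surjectivity, NO `p ≥ 5`, NO Tamagawa
clause. The by-product for crux 19065's inert frames at `p ∈ {5, 7}`. CONDITIONAL on `hCT`, the labels, `hirr`, `hneg`.
[cite: McCallumLMS1991, §1 Theorem (Kolyvagin), Lemma 5.1, Cor. 5.6] [cite: GrossLMS1991, §2, §9, §10]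
[cite: Kim2022HigherGZ, Thm. 4.3 (printed twin)] [cite: MilneADT2006, Ch. I Thm. 4.10(b), Thm. 6.13(a)] -/
theorem natCard_sha_primary_le_of_shimuraLabels_of_irr_of_neg_of_casselsTate
    (hCT : Literature.NumberTheory.EllipticCurves.casselsTate_levelInputs K)
    [W.IsElliptic] [W.IsGloballyMinimal] {N : ℕ} [NeZero N] (hN : W.conductorNorm ℤ = N)
    {p : ℕ} [Fact p.Prime] (hp2 : p ≠ 2) (hirr : W.HasIrreducibleModPGaloisRep p)
    (hneg : ∃ γ : absoluteGaloisGroup ℚ, ∀ P : geomTorsion W p, γ • P = -P)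
    (hK : IsImaginaryQuadratic K) (ι : K →+* ℂ)
    (Dt : ModularParametrizationData W N) {S : Finset ℕ}
    (hin : ∀ ℓ ∈ S, ℓ.Prime ∧ ℓ ∣ N ∧ ¬ ℓ ^ 2 ∣ N ∧
      ((Ideal.span {(ℓ : ℤ)}).primesOver (𝓞 K)).ncard = 1 ∧ ¬ (ℓ : ℤ) ∣ NumberField.discr K)
    (hsp : ∀ ℓ : ℕ, ℓ.Prime → ℓ ∣ N → ℓ ∉ S → ((Ideal.span {(ℓ : ℤ)}).primesOver (𝓞 K)).ncard = 2)
    (hpS : p ∈ S)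
    (ys : (m : ℕ) → (W.baseChange (ringClassField K ι m)).toAffine.Point)
    {y : (W.baseChange K).toAffine.Point} {ε : ℤ} (hε : ε = 1 ∨ ε = -1)
    (hguard : ¬ IsOfFinAddOrder y → 0 < (AddSubgroup.zmultiples y).index)
    (hB2 : ∀ T : Finset (ringClassField K ι 1 ≃ₐ[ℚ] ringClassField K ι 1),
      (∀ g, g ∈ T ↔ g ∈ ringClassGal ι 1) →
      WeierstrassCurve.Affine.Point.map (W' := W)
          (algebraMap K (ringClassField K ι 1)).toRatAlgHom y =
        ∑ g ∈ T, pointGalHom W (ringClassField K ι 1) g (ys 1))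
    (hB3 : ∀ (m : ℕ), m ≠ 0 → ∀ τm : ringClassField K ι m ≃ₐ[ℚ] ringClassField K ι m,
      (∀ x : ringClassField K ι m, ((τm x : ringClassField K ι m) : ℂ) = starRingEnd ℂ x) →
      ∃ σ' ∈ ringClassGal ι m, IsOfFinAddOrder
        (pointGalHom W (ringClassField K ι m) τm (ys m) -
          ε • pointGalHom W (ringClassField K ι m) σ' (ys m)))
    (hB3K : ∀ c : K ≃ₐ[ℚ] K, c ≠ 1 →
      IsOfFinAddOrder (WeierstrassCurve.Affine.Point.map (W' := W) (c : K →ₐ[ℚ] K) y - ε • y))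
    (hB4 : ∀ m : ℕ, Squarefree m →
      (∀ q ∈ m.primeFactors, ¬ q ∣ N ∧ (Ideal.span {(q : 𝓞 K)}).IsPrime) →
      ∀ (ℓ : ℕ) (_ : ℓ ∈ m.primeFactors) (hle : ringClassField K ι (m / ℓ) ≤ ringClassField K ι m)
        (σ : ringClassField K ι m ≃ₐ[ℚ] ringClassField K ι m),
        Subgroup.zpowers σ = ringClassGalOver ι m (m / ℓ) →
        letI : Algebra K ℂ := ι.toAlgebra
        ∑ i ∈ Finset.range (ℓ + 1), pointGalHom W (ringClassField K ι m) (σ ^ i) (ys m) =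
          W.frobeniusTrace ℓ • WeierstrassCurve.Affine.Point.map (W' := W)
            ((RingClassField.inclusion ι hle).restrictScalars ℚ) (ys (m / ℓ)))
    (hB5 : ∀ m : ℕ, Squarefree m →
      (∀ q ∈ m.primeFactors, ¬ q ∣ N ∧ (Ideal.span {(q : 𝓞 K)}).IsPrime) →
      ∀ (ℓ : ℕ) (_ : ℓ ∈ m.primeFactors) [Fact ℓ.Prime] (hΔ : ¬ (ℓ : ℤ) ∣ minimalDiscriminantInt W)
        (φ₀ : absoluteGaloisGroup (ZMod ℓ)), (∀ x : AlgebraicClosure (ZMod ℓ), φ₀ • x = x ^ ℓ) →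
      ∀ (hle : ringClassField K ι (m / ℓ) ≤ ringClassField K ι m)
        (emb : ringClassField K ι m →+* AlgebraicClosure K),
        (∀ x : K, emb (algebraMap K (ringClassField K ι m) x) = algebraMap K (AlgebraicClosure K) x) →
      ∀ (j : (W.baseChange (ringClassField K ι m)).toAffine.Point →+ geomPoints (W.baseChange K)),
        j = WeierstrassCurve.Affine.Point.map (W' := W) emb.toRatAlgHom →
      ∀ γ : ringClassField K ι m ≃ₐ[ℚ] ringClassField K ι m, γ ∈ ringClassGal ι m →
        letI : Algebra K ℂ := ι.toAlgebra
        geomReduction hΔ ((RatClosure.pointsEquiv (K := K) W).symm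
            (j (pointGalHom W (ringClassField K ι m) γ (ys m)))) =
          φ₀ • geomReduction hΔ ((RatClosure.pointsEquiv (K := K) W).symm
            (j (pointGalHom W (ringClassField K ι m) γ
              (WeierstrassCurve.Affine.Point.map (W' := W)
                ((RingClassField.inclusion ι hle).restrictScalars ℚ) (ys (m / ℓ)))))))
    (hnt : ¬ IsOfFinAddOrder y) :
    Nat.card (AddCommGroup.primaryComponent (W.baseChange K).sha p) ≤
      p ^ (2 * padicValNat p (AddSubgroup.zmultiples y).index) := by
  have hp : p.Prime := Fact.out
  -- Poitou–Tate over `K` is a tree THEOREM (`PoitouTateNumberField.lean`)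
  have hPT : poitouTate_sum_localTatePairing_eq_zero K := poitouTate_sum_localTatePairing_eq_zero_holds K
  have hpd : ¬ (p : ℤ) ∣ NumberField.discr K := (hin p hpS).2.2.2.2
  obtain ⟨hIz, hIs, hIc, hIt⟩ := kolyvaginImageInputs_of_irr_of_neg K W S hN hp2 hirr hneg hK hin hsp hpd
  have hKunr : ∀ v : HeightOneSpectrum (𝓞 ℚ), (p : 𝓞 ℚ) ∈ v.asIdeal →
      Algebra.IsUnramifiedIn (𝓞 K) v.asIdeal := isUnramifiedIn_rat_of_not_dvd_discr K hp hpd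
  have htor : ∀ k' : ℕ, k' ≠ 0 → ¬ p ∣ k' →
      ∀ (n' : ℕ) (a : (W.baseChange (ringClassField K ι k')).toAffine.Point),
        ((p ^ n' : ℕ) : ℤ) • a = 0 → a = 0 := by
    intro k' hk' hpk' n' a ha
    have hbot := NoTorsionIrr.torsionBy_pow_ringClassField_eq_bot_of_hasIrreducibleModPGaloisRep W hK ι hk' hp hp2
      hirr (W.exists_weilPairing_holds p) hKunr hpk' n'
    have hmem : a ∈ AddSubgroup.torsionBy (W.baseChange (ringClassField K ι k')).toAffine.Point ((p ^ n' : ℕ) : ℤ) :=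
      (Submodule.mem_torsionBy_iff _ _).mpr ha
    rwa [hbot, AddSubgroup.mem_bot] at hmem
  exact natCard_sha_primary_le_of_shimuraLabels_of_imageInputs_of_casselsTate_of_poitouTate hPT hCT hN hp2 hIz hIs hIc hIt hK
    ι htor Dt hin hsp ys hε hguard hB2 hB3 hB3K hB4 hB5 hnt

end Summit.BirchSwinnertonDyer.BirchSwinnertonDyer.Theorems.ShimuraKolyvaginOfImage

end
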